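import Summits.Ventures.DiscreteObjects.Hadamard.ElemAbelian23Count

/-!
# Hadamard 668 census, family F12 — `C₂₃ × C₂₃`: a set fixed pointwise by two independent elements is fixed by the
# whole group (Lagrange in `(ℤ/23)²`) (kernel)

Framing: lottery ticket; floor = certified bounds/negative ranges.

Cell pub-namedobj (venture DiscreteObjects), target (H), hadamard gen 16.  For commuting permutations `α, β` with
`α²³ = β²³ = 1` and the action `g = (a, b) ↦ α^a β^b` of `(ℤ/23)²`: if a set `F` of points is fixed pointwise by
`α^a β^b` for `g = g₀ ≠ 1` and for `g = h` with `h ≠ 1` NOT on the punctured line `{g₀^k}` of `g₀`, then `F` is fixed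
pointwise by EVERY `α^a β^b` (`fixed_by_all_of_two_23`).  Proof: the pointwise stabiliser is a subgroup of `(ℤ/23)²`
containing `1`, the 22 powers of `g₀` and the 22 powers of `h` (45 distinct elements), and by Lagrange its order divides
`529 = 23²`, so it is everything.  Ours; no `sorry`.
-/

namespace Summit.Ventures.DiscreteObjects.Hadamard

open Finset BigOperators

variable {ι : Type*}

/-- **pointwise stabilisers in `(ℤ/23)²` containing two independent elements are everything.** -/
theorem fixed_by_all_of_two_23 (α β : Equiv.Perm ι) (hα : α ^ 23 = 1) (hβ : β ^ 23 = 1) (hc : Commute α β)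
    (F : Finset ι) {g₀ h : Multiplicative (ZMod 23 × ZMod 23)} (hg₀ : g₀ ≠ 1) (hh : h ≠ 1)
    (hgh : h ∉ (Finset.range 22).image (fun k => g₀ ^ (k + 1)))
    (hFg : ∀ i ∈ F, (α ^ (Multiplicative.toAdd g₀).1.val * β ^ (Multiplicative.toAdd g₀).2.val) i = i)
    (hFh : ∀ i ∈ F, (α ^ (Multiplicative.toAdd h).1.val * β ^ (Multiplicative.toAdd h).2.val) i = i)
    (g : Multiplicative (ZMod 23 × ZMod 23)) :
    ∀ i ∈ F, (α ^ (Multiplicative.toAdd g).1.val * β ^ (Multiplicative.toAdd g).2.val) i = i := by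
  classical
  haveI : Fact (Nat.Prime 23) := ⟨by norm_num⟩
  -- the action as a function
  set σ : Multiplicative (ZMod 23 × ZMod 23) → Equiv.Perm ι :=
    fun g => α ^ (Multiplicative.toAdd g).1.val * β ^ (Multiplicative.toAdd g).2.val with hσ
  have hmul : ∀ a b, σ (a * b) = σ a * σ b := fun a b => pairPerm_mul 23 α β hα hβ hc a b
  have hone : σ 1 = 1 := by simp [hσ]
  have hpow : ∀ a (k : ℕ), σ (a ^ k) = σ a ^ k := fun a k => pairPerm_pow 23 α β hα hβ hc a k
  -- the pointwise stabiliser as a subgroup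
  let K : Subgroup (Multiplicative (ZMod 23 × ZMod 23)) :=
    { carrier := {k | ∀ i ∈ F, σ k i = i}
      one_mem' := by intro i _; rw [hone]; rfl
      mul_mem' := by
        intro a b ha hb i hi
        rw [hmul, Equiv.Perm.mul_apply, hb i hi, ha i hi]
      inv_mem' := by
        intro a ha i hi
        have hinv : σ a⁻¹ = (σ a)⁻¹ := by
          rw [eq_inv_iff_mul_eq_one, ← hmul, inv_mul_cancel, hone]
        rw [hinv]
        have := ha i hi
        conv_lhs => rw [← this]
        simp }
  have hmemK : ∀ k, k ∈ K ↔ ∀ i ∈ F, σ k i = i := fun k => Iff.rfl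
  -- powers of g₀ and of h lie in K
  have hpowK : ∀ a, (∀ i ∈ F, σ a i = i) → ∀ k : ℕ, a ^ k ∈ K := by
    intro a ha k
    rw [hmemK, hpow]
    intro i hi
    induction k with
    | zero => simp
    | succ k ih => rw [pow_succ, Equiv.Perm.mul_apply, ha i hi, ih]
  -- the 45-element set {1} ∪ line g₀ ∪ line h inside K
  set L := insert (1 : Multiplicative (ZMod 23 × ZMod 23))
    ((Finset.range 22).image (fun k => g₀ ^ (k + 1)) ∪ (Finset.range 22).image (fun k => h ^ (k + 1))) with hL
  have hLcard : L.card = 45 := by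
    rw [hL, Finset.card_insert_of_notMem, Finset.card_union_of_disjoint (disjoint_lines hh hgh),
      card_line hg₀, card_line hh]
    rw [Finset.mem_union, not_or]
    exact ⟨one_not_mem_line hg₀, one_not_mem_line hh⟩
  have hLK : ∀ x ∈ L, x ∈ K := by
    intro x hx
    rw [hL, Finset.mem_insert, Finset.mem_union, mem_line_iff, mem_line_iff] at hx
    rcases hx with rfl | ⟨k, -, rfl⟩ | ⟨k, -, rfl⟩
    · exact K.one_mem
    · exact hpowK g₀ hFg (k + 1)
    · exact hpowK h hFh (k + 1)
  -- Lagrange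
  have hcardG : Nat.card (Multiplicative (ZMod 23 × ZMod 23)) = 23 ^ 2 := by
    rw [Nat.card_eq_fintype_card, Fintype.card_multiplicative, Fintype.card_prod, ZMod.card]; norm_num
  have hdvd := Subgroup.card_subgroup_dvd_card K
  rw [hcardG] at hdvd
  obtain ⟨m, hm, hKm⟩ := (Nat.dvd_prime_pow (by norm_num : Nat.Prime 23)).1 hdvd
  have hK45 : 45 ≤ Nat.card K := by
    have hKc : Fintype.card K = (univ.filter fun x => x ∈ K).card :=
      Fintype.card_of_subtype _ (fun x => by simp)
    rw [Nat.card_eq_fintype_card, hKc, ← hLcard]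
    apply Finset.card_le_card
    intro x hx
    simp only [Finset.mem_filter, Finset.mem_univ, true_and]
    exact hLK x hx
  have hm2 : m = 2 := by
    interval_cases m
    · rw [hKm] at hK45; norm_num at hK45
    · rw [hKm] at hK45; norm_num at hK45
    · rfl
  rw [hm2, ← hcardG] at hKm
  have htop : K = ⊤ := (Subgroup.card_eq_iff_eq_top K).1 hKm
  have hg : g ∈ K := by rw [htop]; exact Subgroup.mem_top g
  exact (hmemK g).1 hg

end Summit.Ventures.DiscreteObjects.Hadamard
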